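import Mathlib
import Summits.Ventures.PercRepro2.HCov
import Summits.Ventures.PercRepro2.HCovCubic
import Summits.Ventures.PercRepro2.TriDisagreement
import Summits.Ventures.PercRepro2.TriDisagreementPinned
import Summits.Ventures.PercRepro2.TypedSplit
import Summits.Ventures.PercRepro2.OneTypedEdge
import Summits.Ventures.PercRepro2.StarPattern
import Summits.Ventures.PercRepro2.StarIdentities
import Summits.Ventures.PercRepro2.StarDebt
import Summits.Ventures.PercRepro2.ChainCoeff
import Summits.Ventures.PercRepro2.StarChain
import Summits.Ventures.PercRepro2.StarPayment

/-!
# The `(2,2,1)`-type stars are free under the one-rung product bases (blind cell PercRepro2,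
p1 g12; LEAD-CCW (c⁗⁗⁗) «the (2,2,1)-type stars are free under 2′TRI-CH alone» read with the
product bases, CONJECTURES row 43 in the NEG-108 scope)

The debt identity `star_212` and `B(p₁, T₁) = B(T₁) + E(T; p)` (`Btwo_eq_Bone_add_nestLeaf`) give
`N_(2,1,2) = B(01₁, 02₁) + E(T; 02) + B(02₂) + B(02₁, 12₁)`: two two-hyperedge bases, a type-`2`
base and one chain leaf — so the `(2,1,2)` hard step is FREE as soon as the product bases of
`G − y` plus two blocks of the star and the chain leaves are nonnegative
(**`typedCount_212_nonneg_of_bases`**; `(1,2,2)`: **`typedCount_122_nonneg_of_bases`**). The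
hypotheses are collected in **`OneRungBases`** (scoped, NEG-108: the one-rung-down objects of
GRAPHS — `G − y` a graph plus the pieces of THIS star; never typed hypergraphs with unmarked
vertices, where `H*` has `N = −2`): `0 ≤ B(P₁, Q₁)`, `0 ≤ B(P₂)`, `0 ≤ E(T; p)` for the blocks of
the star. Under `OneRungBases` the `(2,1,2)` and `(1,2,2)` stars are nonnegative
(**`typedCount_212_nonneg_of_oneRung`**, **`typedCount_122_nonneg_of_oneRung`**), while the
`(2,2,2)` star still needs `TvT` (`typedCount_222_nonneg_of_tvT_of_triCH`). Definitions and
implications only; no positivity is claimed.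
-/

namespace Summit.Ventures.PercRepro2

open CovForm CovForm.OneTyped CovForm.TypedRed

namespace StarPattern

section Free

variable {V : Type*} {E : Type*} [Fintype E] [DecidableEq E] {R : Type*} [Field R] [LinearOrder R]
  [IsStrictOrderedRing R] {ends : E → Sym2 V} {o a₁ a₂ a₃ b : V} {s₁ s₂ s₃ : E} {y u₁ u₂ u₃ : V}

/-- **The `(2,1,2)` star in product bases and one chain leaf**:
`N_(2,1,2) = B(01₁, 02₁) + E(T; 02) + B(02₂) + B(02₁, 12₁)`. -/
theorem star_212_bases (F : Finset E) (z : Config E) (τ : E → ℕ)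
    (D : StarData ends o a₁ a₂ a₃ b s₁ s₂ s₃ y u₁ u₂ u₃ (((F.erase s₁).erase s₂).erase s₃)
      (Function.update (Function.update (Function.update z s₁ false) s₂ false) s₃ false))
    (hs₁ : s₁ ∈ F) (hs₂ : s₂ ∈ F) (hs₃ : s₃ ∈ F) (hτ₁ : τ s₁ = 2) (hτ₂ : τ s₂ = 1)
    (hτ₃ : τ s₃ = 2) :
    typedCount F z τ (K3 ends o a₁ a₂ a₃ b : Config E → Config E → Config E → R) =
      Btwo ends o a₁ a₂ a₃ b s₁ s₂ s₃ (((F.erase s₁).erase s₂).erase s₃)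
        (Function.update (Function.update (Function.update z s₁ false) s₂ false) s₃ false) τ
        (true, true, false) (true, false, true) +
      nestLeaf ends o a₁ a₂ a₃ b s₁ s₂ s₃ (((F.erase s₁).erase s₂).erase s₃)
        (Function.update (Function.update (Function.update z s₁ false) s₂ false) s₃ false) τ
        (true, false, true) +
      Btype2 ends o a₁ a₂ a₃ b s₁ s₂ s₃ (((F.erase s₁).erase s₂).erase s₃)
        (Function.update (Function.update (Function.update z s₁ false) s₂ false) s₃ false) τ
        (true, false, true) +
      Btwo ends o a₁ a₂ a₃ b s₁ s₂ s₃ (((F.erase s₁).erase s₂).erase s₃)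
        (Function.update (Function.update (Function.update z s₁ false) s₂ false) s₃ false) τ
        (true, false, true) (false, true, true) := by
  have h := star_212 (R := R) F z τ D hs₁ hs₂ hs₃ hτ₁ hτ₂ hτ₃
  rw [Btwo_eq_Bone_add_nestLeaf] at h
  linarith

/-- **The `(1,2,2)` star in product bases and one chain leaf**:
`N_(1,2,2) = B(01₁, 12₁) + E(T; 12) + B(02₁, 12₁) + B(12₂)`. -/
theorem star_122_bases (F : Finset E) (z : Config E) (τ : E → ℕ)
    (D : StarData ends o a₁ a₂ a₃ b s₁ s₂ s₃ y u₁ u₂ u₃ (((F.erase s₁).erase s₂).erase s₃)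
      (Function.update (Function.update (Function.update z s₁ false) s₂ false) s₃ false))
    (hs₁ : s₁ ∈ F) (hs₂ : s₂ ∈ F) (hs₃ : s₃ ∈ F) (hτ₁ : τ s₁ = 1) (hτ₂ : τ s₂ = 2)
    (hτ₃ : τ s₃ = 2) :
    typedCount F z τ (K3 ends o a₁ a₂ a₃ b : Config E → Config E → Config E → R) =
      Btwo ends o a₁ a₂ a₃ b s₁ s₂ s₃ (((F.erase s₁).erase s₂).erase s₃)
        (Function.update (Function.update (Function.update z s₁ false) s₂ false) s₃ false) τ
        (true, true, false) (false, true, true) +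
      nestLeaf ends o a₁ a₂ a₃ b s₁ s₂ s₃ (((F.erase s₁).erase s₂).erase s₃)
        (Function.update (Function.update (Function.update z s₁ false) s₂ false) s₃ false) τ
        (false, true, true) +
      Btwo ends o a₁ a₂ a₃ b s₁ s₂ s₃ (((F.erase s₁).erase s₂).erase s₃)
        (Function.update (Function.update (Function.update z s₁ false) s₂ false) s₃ false) τ
        (true, false, true) (false, true, true) +
      Btype2 ends o a₁ a₂ a₃ b s₁ s₂ s₃ (((F.erase s₁).erase s₂).erase s₃)
        (Function.update (Function.update (Function.update z s₁ false) s₂ false) s₃ false) τ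
        (false, true, true) := by
  have h := star_122 (R := R) F z τ D hs₁ hs₂ hs₃ hτ₁ hτ₂ hτ₃
  rw [Btwo_eq_Bone_add_nestLeaf] at h
  linarith

/-- **The `(2,1,2)` star is free under the product bases and the chain leaf.** -/
theorem typedCount_212_nonneg_of_bases (F : Finset E) (z : Config E) (τ : E → ℕ)
    (D : StarData ends o a₁ a₂ a₃ b s₁ s₂ s₃ y u₁ u₂ u₃ (((F.erase s₁).erase s₂).erase s₃)
      (Function.update (Function.update (Function.update z s₁ false) s₂ false) s₃ false))
    (hs₁ : s₁ ∈ F) (hs₂ : s₂ ∈ F) (hs₃ : s₃ ∈ F) (hτ₁ : τ s₁ = 2) (hτ₂ : τ s₂ = 1)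
    (hτ₃ : τ s₃ = 2)
    (h1 : 0 ≤ Btwo (R := R) ends o a₁ a₂ a₃ b s₁ s₂ s₃ (((F.erase s₁).erase s₂).erase s₃)
      (Function.update (Function.update (Function.update z s₁ false) s₂ false) s₃ false) τ
      (true, true, false) (true, false, true))
    (h2 : 0 ≤ nestLeaf (R := R) ends o a₁ a₂ a₃ b s₁ s₂ s₃ (((F.erase s₁).erase s₂).erase s₃)
      (Function.update (Function.update (Function.update z s₁ false) s₂ false) s₃ false) τ
      (true, false, true))
    (h3 : 0 ≤ Btype2 (R := R) ends o a₁ a₂ a₃ b s₁ s₂ s₃ (((F.erase s₁).erase s₂).erase s₃)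
      (Function.update (Function.update (Function.update z s₁ false) s₂ false) s₃ false) τ
      (true, false, true))
    (h4 : 0 ≤ Btwo (R := R) ends o a₁ a₂ a₃ b s₁ s₂ s₃ (((F.erase s₁).erase s₂).erase s₃)
      (Function.update (Function.update (Function.update z s₁ false) s₂ false) s₃ false) τ
      (true, false, true) (false, true, true)) :
    0 ≤ typedCount F z τ (K3 ends o a₁ a₂ a₃ b : Config E → Config E → Config E → R) := by
  rw [star_212_bases F z τ D hs₁ hs₂ hs₃ hτ₁ hτ₂ hτ₃]
  linarith

/-- **The `(1,2,2)` star is free under the product bases and the chain leaf.** -/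
theorem typedCount_122_nonneg_of_bases (F : Finset E) (z : Config E) (τ : E → ℕ)
    (D : StarData ends o a₁ a₂ a₃ b s₁ s₂ s₃ y u₁ u₂ u₃ (((F.erase s₁).erase s₂).erase s₃)
      (Function.update (Function.update (Function.update z s₁ false) s₂ false) s₃ false))
    (hs₁ : s₁ ∈ F) (hs₂ : s₂ ∈ F) (hs₃ : s₃ ∈ F) (hτ₁ : τ s₁ = 1) (hτ₂ : τ s₂ = 2)
    (hτ₃ : τ s₃ = 2)
    (h1 : 0 ≤ Btwo (R := R) ends o a₁ a₂ a₃ b s₁ s₂ s₃ (((F.erase s₁).erase s₂).erase s₃)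
      (Function.update (Function.update (Function.update z s₁ false) s₂ false) s₃ false) τ
      (true, true, false) (false, true, true))
    (h2 : 0 ≤ nestLeaf (R := R) ends o a₁ a₂ a₃ b s₁ s₂ s₃ (((F.erase s₁).erase s₂).erase s₃)
      (Function.update (Function.update (Function.update z s₁ false) s₂ false) s₃ false) τ
      (false, true, true))
    (h3 : 0 ≤ Btwo (R := R) ends o a₁ a₂ a₃ b s₁ s₂ s₃ (((F.erase s₁).erase s₂).erase s₃)
      (Function.update (Function.update (Function.update z s₁ false) s₂ false) s₃ false) τ
      (true, false, true) (false, true, true))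
    (h4 : 0 ≤ Btype2 (R := R) ends o a₁ a₂ a₃ b s₁ s₂ s₃ (((F.erase s₁).erase s₂).erase s₃)
      (Function.update (Function.update (Function.update z s₁ false) s₂ false) s₃ false) τ
      (false, true, true)) :
    0 ≤ typedCount F z τ (K3 ends o a₁ a₂ a₃ b : Config E → Config E → Config E → R) := by
  rw [star_122_bases F z τ D hs₁ hs₂ hs₃ hτ₁ hτ₂ hτ₃]
  linarith

end Free

section OneRung

variable {V : Type*} {E : Type*} [Fintype E] [DecidableEq E] {R : Type*} [Field R] [LinearOrder R]

/-- **The one-rung product bases of a star**: every two-block base `B(P₁, Q₁)`, every type-`2` base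
`B(P₂)` and every nested leaf `E(T; p)` of the star's blocks over the typed instance is
nonnegative. A definition only. SCOPE (NEG-108): conjectured for the one-rung-down objects of
GRAPHS — `(F₀, z₀, τ)` the typed edges of `G − y`, `G` a finite graph (unmarked vertices
allowed), the blocks the pieces of THIS star — and for the five-mark base; NOT for typed
hypergraphs with unmarked vertices (`H*`: `N = −2`). -/
def OneRungBases (ends : E → Sym2 V) (o a₁ a₂ a₃ b : V) (s₁ s₂ s₃ : E) (F₀ : Finset E)
    (z₀ : Config E) (τ : E → ℕ) : Prop :=
  (∀ P Q : Bool × Bool × Bool, 0 ≤ Btwo (R := R) ends o a₁ a₂ a₃ b s₁ s₂ s₃ F₀ z₀ τ P Q) ∧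
  (∀ P : Bool × Bool × Bool, 0 ≤ Btype2 (R := R) ends o a₁ a₂ a₃ b s₁ s₂ s₃ F₀ z₀ τ P) ∧
  (∀ p : Bool × Bool × Bool, 0 ≤ nestLeaf (R := R) ends o a₁ a₂ a₃ b s₁ s₂ s₃ F₀ z₀ τ p)

variable [IsStrictOrderedRing R] {ends : E → Sym2 V} {o a₁ a₂ a₃ b : V} {s₁ s₂ s₃ : E}
  {y u₁ u₂ u₃ : V}

/-- **Under the one-rung bases the `(2,1,2)` star is nonnegative.** -/
theorem typedCount_212_nonneg_of_oneRung (F : Finset E) (z : Config E) (τ : E → ℕ)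
    (D : StarData ends o a₁ a₂ a₃ b s₁ s₂ s₃ y u₁ u₂ u₃ (((F.erase s₁).erase s₂).erase s₃)
      (Function.update (Function.update (Function.update z s₁ false) s₂ false) s₃ false))
    (hs₁ : s₁ ∈ F) (hs₂ : s₂ ∈ F) (hs₃ : s₃ ∈ F) (hτ₁ : τ s₁ = 2) (hτ₂ : τ s₂ = 1)
    (hτ₃ : τ s₃ = 2)
    (hB : OneRungBases (R := R) ends o a₁ a₂ a₃ b s₁ s₂ s₃ (((F.erase s₁).erase s₂).erase s₃)
      (Function.update (Function.update (Function.update z s₁ false) s₂ false) s₃ false) τ) :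
    0 ≤ typedCount F z τ (K3 ends o a₁ a₂ a₃ b : Config E → Config E → Config E → R) :=
  typedCount_212_nonneg_of_bases F z τ D hs₁ hs₂ hs₃ hτ₁ hτ₂ hτ₃ (hB.1 _ _) (hB.2.2 _)
    (hB.2.1 _) (hB.1 _ _)

/-- **Under the one-rung bases the `(1,2,2)` star is nonnegative.** -/
theorem typedCount_122_nonneg_of_oneRung (F : Finset E) (z : Config E) (τ : E → ℕ)
    (D : StarData ends o a₁ a₂ a₃ b s₁ s₂ s₃ y u₁ u₂ u₃ (((F.erase s₁).erase s₂).erase s₃)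
      (Function.update (Function.update (Function.update z s₁ false) s₂ false) s₃ false))
    (hs₁ : s₁ ∈ F) (hs₂ : s₂ ∈ F) (hs₃ : s₃ ∈ F) (hτ₁ : τ s₁ = 1) (hτ₂ : τ s₂ = 2)
    (hτ₃ : τ s₃ = 2)
    (hB : OneRungBases (R := R) ends o a₁ a₂ a₃ b s₁ s₂ s₃ (((F.erase s₁).erase s₂).erase s₃)
      (Function.update (Function.update (Function.update z s₁ false) s₂ false) s₃ false) τ) :
    0 ≤ typedCount F z τ (K3 ends o a₁ a₂ a₃ b : Config E → Config E → Config E → R) :=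
  typedCount_122_nonneg_of_bases F z τ D hs₁ hs₂ hs₃ hτ₁ hτ₂ hτ₃ (hB.1 _ _) (hB.2.2 _)
    (hB.1 _ _) (hB.2.1 _)

end OneRung

end StarPattern

end Summit.Ventures.PercRepro2
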